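import HarnessLib
import Summits.HodgeConjecture.HodgeConjecture.Cruxes.H413.Lines.K2_E3_EllipticInputs           -- tier 0 (namespace ∕ opens of record; Lines→Lines import, statements only)
import Summits.HodgeConjecture.HodgeConjecture.Theorems.K2E3QuasiSplitTwoTorusDefs             -- ★ D115 p860691 (K2E3-p21) (TOR₂-Defs): `K2E3QuasiSplitTwoTorusDefs.dgFormula₂` = the N = 2 Weyl denominator `dg₂` of the statement

/-!
# K2_E3_EllipticInputs ∕ U12Characters — PART «RankCI» (tier 1): the LETTER SOCKET (res-ω-CI) of the RANK leaf (res-ω)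
# `sig_K2E3CharLocIntNearIdentityOmegaQuasiSplitTwo` (PART «RANK» §R2ω), hosted apart (S-layer letter hosts live in their own files, as PART «RES3»).

WHY (K2E3-typ3 g0, ED. 1, 2026-09-04; dealer K2E3-plan (g4) D169 16:08:51Z SHAPE (B) «NEW PART RankCI = ONE socket (res-ω-CI) + RANK ED. 7 importing it with (res-ω) tied»;
K2E3-p21 (g8) NR-3 handoff 15:51:40Z).  The RANK leaf (res-ω) asks row 11 AT THE IDENTITY for both members `π⁺ ⊆ i_G(χ) ↠ π⁻` of the ω-packet of a REDUCIBLE principal series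
`i_G(χ) = cmPrincipalSeries L 2 v χ` of `G = U(Φ₂)(L⁺_v)` (`v` non-split, no finite-dimensional constituents: branch (C) of ★ D122).  ★ D142 p861578
`K2E3CharLocIntNearIdentityOmegaQuasiSplitTwoOfU2CharIdentity.omegaQuasiSplitTwo_of_u2CharIdentity (hCI)` concludes (res-ω) VERBATIM from ONE letter `hCI` = the ω-packet
endoscopic character identity at function level («`Tr π⁺ − Tr π⁻ = ∫ f · dg₂⁻¹ · κ` near `1`, `κ` measurable and bounded on compacts»), using ★ D121∕D122 (packet structure), ★ p861123
(ASM₂-rep) (`Θ_{i_G(χ)} ∈ L¹` near `1`), ★ HCD₂ (`dg₂⁻¹ ∈ L¹_loc`) and ★ (LC).  THIS FILE hosts that letter as the socket below; RANK ED. 7 ties (res-ω) over it BY NAME.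

CONTENT (ED. 1).  ONE socket, bytes = the `hCI` binder of the TREE head theorem ★ D142 (`Theorems/K2E3CharLocIntNearIdentityOmegaQuasiSplitTwoOfU2CharIdentity.lean` c976b97bf3a6576d :96–)
TOKEN FOR TOKEN (generator-extracted and asserted ≡ K2E3-p21 (g8) letter v2 `K2/K2E3-p21/g8/subsocket_res-omega-CI.text.txt` 8eb68838a107f36b):
* **(res-ω-CI) `sig_K2E3OmegaQuasiSplitTwoU2CharIdentity`** — OPEN, XL, S-LAYER-adjacent (K2-lead R37: no 8th printed citation; the identity is a theorem in print — Rogawski §12.1, Labesse–Langlands §3 —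
  but not among the 7).  CONSUMER: RANK (res-ω) `:= K2E3CharLocIntNearIdentityOmegaQuasiSplitTwoOfU2CharIdentity.omegaQuasiSplitTwo_of_u2CharIdentity sig_K2E3OmegaQuasiSplitTwoU2CharIdentity` (RANK ED. 7).
Sorries in THIS file = 1 = {(res-ω-CI)}.  COUNT-NEUTRAL: with RANK ED. 7 the (res-ω) sorry MOVES here (RANK 1 → 0, RankCI 0 → 1); nothing is paid.  Imports: HarnessLib + tier 0 +
★ D115 (TOR₂-Defs) only — a pure statement host (Theorems never import it; RANK imports it from ED. 7; acyclic).

§ EDITIONS (this PART).  ED. 1 (K2E3-typ3 g0, generator `K2/K2E3-typ3/g0/mk_rankci_ed1.py`; scratch pin `probe_rankci_tie.scratch.lean` = this body + tree RANK ED. 6 fa7bd0279a8b775a + ★ D142: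
`theorem resOmega_pin : ‹(res-ω) VERBATIM› := K2E3CharLocIntNearIdentityOmegaQuasiSplitTwoOfU2CharIdentity.omegaQuasiSplitTwo_of_u2CharIdentity sig_K2E3OmegaQuasiSplitTwoU2CharIdentity` farm rc 0): created.

HONEST LABEL: HC_CM is proved only modulo the 7 printed citations (2 remaining named inputs: hLiu418 = stmt-HodgeConjecture-24832, h413 = stmt-HodgeConjecture-24833) until rung 0 closes; REL ≠ ★. -/

open NumberField IsDedekindDomain MeasureTheory
open scoped Matrix MatrixGroups Valued NNReal
open Literature.NumberTheory.Rogawski1990 Literature.NumberTheory.Automorphic Literature.NumberTheory.Automorphic.UnitaryGroup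
open Literature.NumberTheory.Automorphic.UnitaryGroup.CotangentForms Literature.NumberTheory.GaloisRepresentations
open Literature.NumberTheory.Automorphic.Arthur2013.Leaves.TECR
open Summit.HodgeConjecture.HodgeConjecture.Cruxes.H413.F0P3cStCharTSPaydown

namespace Summit.HodgeConjecture.HodgeConjecture.Cruxes.H413.K2E3EllipticInputs.U12Characters

/-! ## §RCI (ED. 1) — LEAF (res-ω-CI): the letter of ★ D142 `omegaQuasiSplitTwo_of_u2CharIdentity` (K2E3-p21 (g8) letter v2) -/

set_option maxHeartbeats 1600000 in
set_option synthInstance.maxHeartbeats 400000 in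
/-- **LEAF (res-ω-CI) `sig_K2E3OmegaQuasiSplitTwoU2CharIdentity`** — «THE ω-PACKET CHARACTER IDENTITY AT FUNCTION LEVEL» on `G = U(Φ₂)(L⁺_v)`, `v` non-split: for `χ` continuous with
`i_G(χ) = cmPrincipalSeries L 2 v χ` REDUCIBLE and WITHOUT finite-dimensional constituents, and every subrepresentation `N` with `⊥ ≠ N ≠ ⊤` (so `N = π⁺`, `i_G(χ)⁄N = π⁻`, JH =
`{π⁺, π⁻}`: ★ D121 `not_bot_lt_lt_lt_top_cmPrincipalSeries_two`, ★ D122 `omega_structure_cmPrincipalSeries_two`), there are a MEASURABLE `κ : G → ℂ`, BOUNDED ON COMPACTS, and an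
open `U ∋ 1` with
  `Tr π⁺(f) − Tr π⁻(f) = ∫_G f(g) · dg₂(g)⁻¹ · κ(g) dμ(g)`   for every Schwartz–Bruhat `f` supported in `U`,
where `dg₂ = K2E3QuasiSplitTwoTorusDefs.dgFormula₂ L v` is the N = 2 Weyl denominator `|D_G|^{1∕2}` (★ D115; `dg₂⁻¹ ∈ L¹_loc(G)` ★ HCD₂, so the right side is an `L¹_loc` FUNCTION —
★ D142 §1 `locallyIntegrable_dgFormula₂_inv_mul_of_bdd`).  PRINT: `{π⁺, π⁻} = ρ(χ′)` is the endoscopic `L`-packet of `U(1,1)` attached to a character `χ′` of `H = U(1) × U(1)` and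
`Θ_{π⁺} − Θ_{π⁻} = ±χ′^G`, the transfer of `χ′` (`D_G · χ′^G` bounded: a finite sum of unitary characters over the stable class, the L. 12.5.1-type formula at N = 2) — Rogawski §12.1
pp. 171–172 (the packets `ρ` of `U(1,1)` and their character relations), Labesse–Langlands §3 (`SL₂`-type `L`-indistinguishability); equivalently Harish-Chandra's germ expansion at
`N = 2` for each member.  HONEST: an OPEN printed-identity letter (K2-lead R37: NO 8th printed citation — a theorem in print but not among the 7), S-LAYER-adjacent, XL; hosting it
MOVES the (res-ω) sorry here and pays none: (res-ω) becomes REL over EXACTLY {(res-ω-CI)} (RANK ED. 7).  ROAD-NEUTRAL: the N = 2 germ road ((12D-2) + (L-A_U)′ at N = 2, PART «LIE»)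
pays it with `κ := dg₂ · (Θ_{π⁺} − Θ_{π⁻})`; the R90-TF S-layer pays it by the endoscopic transfer.  Statement = ★ D142's `hCI` binder TOKEN FOR TOKEN (carrier
`↥(unitaryGroupOfForm (conjLocal L (IsCMField.complexConj L) v) (cmLocalForm L 2 v))`, the organ's semi-local home of ★ `cmPrincipalSeries L 2 v`, as (res-ω)).
[cite: Rogawski1990, §12.1 pp. 171–172; L. 12.5.1 p. 184] [cite: LabesseLanglands1979, §3] [cite: HarishChandra1999, Thm. 16.1 p. 77, §18] [cite: HarishChandra1970, Part VII §3 Thm. 16]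
Size: XL, S-LAYER-adjacent.  PAYER: the R90-TF S-layer socket (by name, later) or the N = 2 germ road; CONSUMER: ★ D142 `omegaQuasiSplitTwo_of_u2CharIdentity (hCI)` ⇒ RANK (res-ω) (ED. 7 tie).  STATE: OPEN. -/
theorem sig_K2E3OmegaQuasiSplitTwoU2CharIdentity :
  ∀ (L : Type) [Field L] [NumberField L] [IsCMField L] (v : HeightOneSpectrum (𝓞 ↥(maximalRealSubfield L))),
      (∀ w : PlacesOver L v, IsCMField.complexConj L • w.1 = w.1) →
      ∀ [MeasurableSpace ↥(unitaryGroupOfForm (conjLocal L (IsCMField.complexConj L) v) (cmLocalForm L 2 v))] [BorelSpace ↥(unitaryGroupOfForm (conjLocal L (IsCMField.complexConj L) v) (cmLocalForm L 2 v))]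
        (μ : Measure ↥(unitaryGroupOfForm (conjLocal L (IsCMField.complexConj L) v) (cmLocalForm L 2 v))) [μ.IsHaarMeasure]
        (χ : ↥(cmBorelTriple L 2 v).M →* ℂˣ), Continuous (fun t => ((χ t : ℂˣ) : ℂ)) →
        ¬ (UnitaryGroup.cmPrincipalSeries L 2 v χ).IsIrreducible →
        (∀ r : SmoothIrrep ↥(unitaryGroupOfForm (conjLocal L (IsCMField.complexConj L) v) (cmLocalForm L 2 v)), (IrrClass.mk r).IsConstituentOf (UnitaryGroup.cmPrincipalSeries L 2 v χ) → ¬ FiniteDimensional ℂ r.V) →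
        ∀ (N : Subrepresentation (UnitaryGroup.cmPrincipalSeries L 2 v χ)), N ≠ ⊥ → N ≠ ⊤ →
        ∃ κ : ↥(unitaryGroupOfForm (conjLocal L (IsCMField.complexConj L) v) (cmLocalForm L 2 v)) → ℂ, Measurable κ ∧
          (∀ K : Set ↥(unitaryGroupOfForm (conjLocal L (IsCMField.complexConj L) v) (cmLocalForm L 2 v)), IsCompact K → ∃ B : ℝ, ∀ x ∈ K, ‖κ x‖ ≤ B) ∧
          ∃ U : Set ↥(unitaryGroupOfForm (conjLocal L (IsCMField.complexConj L) v) (cmLocalForm L 2 v)), IsOpen U ∧ (1 : ↥(unitaryGroupOfForm (conjLocal L (IsCMField.complexConj L) v) (cmLocalForm L 2 v))) ∈ U ∧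
            ∀ f : ↥(unitaryGroupOfForm (conjLocal L (IsCMField.complexConj L) v) (cmLocalForm L 2 v)) → ℂ, f ∈ SchwartzBruhat ↥(unitaryGroupOfForm (conjLocal L (IsCMField.complexConj L) v) (cmLocalForm L 2 v)) →
              tsupport f ⊆ U →
              N.toRepresentation.smoothTrace μ f - N.quotientRep.smoothTrace μ f =
                ∫ g, f g * ((((K2E3QuasiSplitTwoTorusDefs.dgFormula₂ L v g)⁻¹ : ℝ) : ℂ) * κ g) ∂μ := by
  sorry

end Summit.HodgeConjecture.HodgeConjecture.Cruxes.H413.K2E3EllipticInputs.U12Characters
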